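import Literature.Probability.RandomPlanarGeometry.SAWPolygonJoinParity
import Mathlib.Analysis.SpecialFunctions.Pow.Real
import Mathlib.Analysis.SpecialFunctions.Sqrt

/-!
# Madras' polygon join on `ℤ²` with an explicit constant: the statements (cap gadget, tall polygons, the
# join inequality `√n · p_n² ≤ 2 · p_{2n+16}`, and the bound `p_m ≤ 2 μ¹⁶ (m+16)^{-1/2} μ^m`)

Topic `Literature/Probability/RandomPlanarGeometry` (continues `SAWPolygonJoinParity.lean`: join plaquettes, ray parity,
`UniqueInteriorEqNeck`; `SAWWidePolygons.lean`: `normPolygons m` = `SAP_m` up to translation).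

Sources.  N. Madras, *A rigorous bound on the critical exponent for the number of lattice trees, animals, and polygons*,
J. Stat. Phys. 78 (1995) 681–699 [Madras1995LatticeAnimalsExponent]: in `d = 2` the number `p_n` of `n`-step self-avoiding
polygons up to translation satisfies `p_n ≤ A n^{-1/2} μ^n` (quoted by A. Hammond, *On self-avoiding polygons and walks:
counting, joining and closing*, arXiv:1504.05286 [Hammond2015SAPJoining], §2 p. 4 (arXiv v5, 2017; all pages below are v5
pages): "he has shown in [Madras95] using a polygon
joining technique that `θ_n ≥ 1/2 − o(1)` for `d = 2`").  The JOIN is Madras' procedure as recalled in [Hammond2015SAPJoining,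
§4.1 pp. 17–20]: slide `σ` leftwards against `τ` until a first column coincidence at vertical distance `≤ 2`, let `Y` be the
contact site, cap `τ` to the right of `Y` and (after a half-turn about `Y`) `σ'` to the left, each cap adding `8` edges and
ending in a vertical 2-segment two or three units into the empty corridor, shift by `T₂ ∈ {5,6,7}` and merge across the
junction plaquette `P¹`: "`J(τ,σ) = (τ̃ ∪ (σ̃ + T₂ e₁)) Δ P¹ ∈ SAP_{n+m+16}`" (Definition 4.3, p. 20; `τ̃`, `σ̃` = the printed
`τ_mod`, `σ_mod`).

This file fixes the STATEMENTS of the lane's explicit-constant version of Madras' bound (venture «pcv-sawmu», route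
MAD95-2JP, a-idea-2's Sketch_v6 v6.4 — all definitions below are reproduced VERBATIM from it): the local cap rule is
abstracted as `CapGadget` (S2; Madras' Figure-2 rule is replaced by any rule with the listed properties, including
translation equivariance), the decoding uses `UniqueInteriorEqNeck` (S3⁺, proved in `SAWPolygonJoinParity.lean`), and
the counting gives `JoinIneq2` (S5⁺) and, by a doubling bootstrap (S6), `MAD95_Explicit2`: `p_m ≤ 2 μ¹⁶ (m+16)^{-1/2} μ^m`
for every even `m ≥ 4` — Madras' theorem with the explicit constant `A = 2 μ¹⁶`.  The proofs of S2 and S4+S5 are in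
`SAWPolygonJoinCap.lean` and `SAWPolygonJoinMap.lean`; S1 (tall polygons) and S6 (bootstrap) in their own files.

## Contents (namespace `Literature.Probability.RandomPlanarGeometry.SAW.JoinParity`; no proofs except compositions)

* `CapHyp`, `CapSpec`, `CapGadget` (+ `capGadget_iff`) — the cap gadget (S2) as a Prop;
* `IsTall`, `TallHalf` (S1a), `TallHeight` (S1b);
* `JoinIneq2` (S5⁺), `JoinMapSpec` (the S4 target shape) and `joinIneq2_of_spec`; `Counting2` (S1 + S2 + S3⁺ ⇒ S5⁺);
* `PolygonLimit`, `MAD95_Explicit2` (the target), `Bootstrap2` (S6), the assembly `mad95_explicit2_of`, and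
  `exists_A_of_explicit2` (the printed `∃ A` form).
-/

noncomputable section

open Filter Topology Finset SimpleGraph Literature.Probability.LatticeModels Literature.Probability.Percolation
open Literature.Barriers.CriticalPhenomena.SupercriticalSAW (shiftEdges)
open Literature.Probability.Percolation.SiteGadgetSystem (vertsOf mem_vertsOf)
open Literature.Probability.RandomPlanarGeometry.SAW

namespace Literature.Probability.RandomPlanarGeometry.SAW.JoinParity

/-! ### S2: the cap gadget -/

/-- `Y`'s column triple meets `τ`, and the right corridor `{x > Y₀} × {Y₁-1, Y₁, Y₁+1}` misses `τ` ("no vertex of `τ`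
belongs to the right corridor … Indeed, it is this fact that implies that `τ̃` is a polygon").
[cite: Hammond2015SAPJoining, §4.1 pp. 17–18 (the vertex Y and the empty right corridor; arXiv v5)] -/
def CapHyp (τ : Finset (Sym2 (Site 2))) (Y : Site 2) : Prop :=
  (∃ t ∈ vertsOf τ, t 0 = Y 0 ∧ |t 1 - Y 1| ≤ 1) ∧ (∀ v ∈ vertsOf τ, Y 0 < v 0 → 1 < |v 1 - Y 1|)

/-- The properties of a cap rule `(cap, ext)`: for a polygon `τ` with `CapHyp τ Y`, `cap τ Y` is a polygon with `#τ + 8`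
edges ("either two edges are removed and ten edges added … or one edge is removed and nine are added"), ending in the
vertical 2-segment at column `Y₀ + ext`, `ext ∈ {2,3}` ("extends `τ` to the right of `Y` by either two or three units
inside the right corridor"), with nothing to its right in the corridor rows, equal to `τ` away from the window;
injective given `(Y₀ + ext, Y₁)`; and commuting with translations.
[cite: Hammond2015SAPJoining, §4.1 p. 18 (the modified polygon τ̃ = τ_mod; arXiv v5)] -/
def CapSpec (cap : Finset (Sym2 (Site 2)) → Site 2 → Finset (Sym2 (Site 2)))
    (ext : Finset (Sym2 (Site 2)) → Site 2 → ℤ) : Prop :=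
  (∀ τ Y, IsPolygon (zdGraph 2) τ → CapHyp τ Y →
      IsPolygon (zdGraph 2) (cap τ Y) ∧ (cap τ Y).card = τ.card + 8 ∧
      (ext τ Y = 2 ∨ ext τ Y = 3) ∧
      s((![Y 0 + ext τ Y, Y 1 - 1] : Site 2), ![Y 0 + ext τ Y, Y 1]) ∈ cap τ Y ∧
      s((![Y 0 + ext τ Y, Y 1] : Site 2), ![Y 0 + ext τ Y, Y 1 + 1]) ∈ cap τ Y ∧
      (∀ v ∈ vertsOf (cap τ Y), |v 1 - Y 1| ≤ 1 → v 0 ≤ Y 0 + ext τ Y) ∧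
      (∀ e, (e ∈ cap τ Y ↔ e ∈ τ) ∨ (∀ v ∈ (e : Sym2 (Site 2)).toFinset, Y 0 - 1 ≤ v 0 ∧ |v 1 - Y 1| ≤ 1))) ∧
    (∀ τ τ' Y Y', IsPolygon (zdGraph 2) τ → CapHyp τ Y → IsPolygon (zdGraph 2) τ' → CapHyp τ' Y' →
      Y 1 = Y' 1 → Y 0 + ext τ Y = Y' 0 + ext τ' Y' → cap τ Y = cap τ' Y' → τ = τ') ∧
    (∀ τ Y t, IsPolygon (zdGraph 2) τ → CapHyp τ Y →
      cap (shiftEdges t τ) (Y + t) = shiftEdges t (cap τ Y) ∧ ext (shiftEdges t τ) (Y + t) = ext τ Y)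

/-- **S2 (CAP GADGET LEMMA)**: a local rule `cap` turning `τ ∈ SAP_n` into `τ̃ ∈ SAP_{n+8}` which (i) differs
from `τ` only at window sites `{Y₀-1 ≤ x} × {|y - Y₁| ≤ 1}`, (ii) ends in the corridor with the vertical
2-segment at column `X = Y₀ + ext`, `ext ∈ {2,3}`, nothing of `τ̃` to the right of `X` in the corridor rows,
(iii) is injective given `(X, Y₁)`, (iv) commutes with translations.  Proved in `SAWPolygonJoinCap.lean`.
[cite: Hammond2015SAPJoining, §4.1 p. 18 and Figure 2 p. 19 (Madras' local modification; arXiv v5)] -/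
def CapGadget : Prop :=
  ∃ cap : Finset (Sym2 (Site 2)) → Site 2 → Finset (Sym2 (Site 2)),
  ∃ ext : Finset (Sym2 (Site 2)) → Site 2 → ℤ,
    (∀ τ Y, IsPolygon (zdGraph 2) τ → CapHyp τ Y →
      IsPolygon (zdGraph 2) (cap τ Y) ∧ (cap τ Y).card = τ.card + 8 ∧
      (ext τ Y = 2 ∨ ext τ Y = 3) ∧
      s((![Y 0 + ext τ Y, Y 1 - 1] : Site 2), ![Y 0 + ext τ Y, Y 1]) ∈ cap τ Y ∧
      s((![Y 0 + ext τ Y, Y 1] : Site 2), ![Y 0 + ext τ Y, Y 1 + 1]) ∈ cap τ Y ∧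
      (∀ v ∈ vertsOf (cap τ Y), |v 1 - Y 1| ≤ 1 → v 0 ≤ Y 0 + ext τ Y) ∧
      (∀ e, (e ∈ cap τ Y ↔ e ∈ τ) ∨ (∀ v ∈ (e : Sym2 (Site 2)).toFinset, Y 0 - 1 ≤ v 0 ∧ |v 1 - Y 1| ≤ 1))) ∧
    (∀ τ τ' Y Y', IsPolygon (zdGraph 2) τ → CapHyp τ Y → IsPolygon (zdGraph 2) τ' → CapHyp τ' Y' →
      Y 1 = Y' 1 → Y 0 + ext τ Y = Y' 0 + ext τ' Y' → cap τ Y = cap τ' Y' → τ = τ') ∧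
    (∀ τ Y t, IsPolygon (zdGraph 2) τ → CapHyp τ Y →
      cap (shiftEdges t τ) (Y + t) = shiftEdges t (cap τ Y) ∧ ext (shiftEdges t τ) (Y + t) = ext τ Y)

/-- `CapGadget` is literally `∃ cap ext, CapSpec cap ext`.
[cite: Hammond2015SAPJoining, §4.1 p. 18 (Madras' local modification; arXiv v5)] -/
theorem capGadget_iff : CapGadget ↔
    ∃ cap : Finset (Sym2 (Site 2)) → Site 2 → Finset (Sym2 (Site 2)),
    ∃ ext : Finset (Sym2 (Site 2)) → Site 2 → ℤ, CapSpec cap ext := Iff.rfl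

/-! ### S1: tall polygons -/

/-- `height(E) ≥ width(E)`, phrased without `sup`/`inf`.
[cite: Hammond2015SAPJoining, §3.1.3 p. 9 (height and width of a polygon; arXiv v5)] -/
def IsTall (E : Finset (Sym2 (Site 2))) : Prop :=
  ∃ a ∈ vertsOf E, ∃ b ∈ vertsOf E, ∀ v ∈ vertsOf E, ∀ w ∈ vertsOf E, v 0 - w 0 ≤ a 1 - b 1

open Classical in
/-- S1a: by the quarter-turn (coordinate swap) symmetry at least half of `SAP_n` is tall.
[cite: Madras1995LatticeAnimalsExponent, §2 (joining at Ω(n^{1/2}) heights)] -/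
def TallHalf : Prop :=
  ∀ n : ℕ, (normPolygons n).card ≤ 2 * ((normPolygons n).filter IsTall).card

/-- S1b: a tall `n`-gon has height `h` with `(h+1)² ≥ n` (its `n` vertices sit in a `(w+1)×(h+1)` box).
[cite: Madras1995LatticeAnimalsExponent, §2 (joining at Ω(n^{1/2}) heights)] -/
def TallHeight : Prop :=
  ∀ n : ℕ, ∀ E ∈ normPolygons n, IsTall E →
    ∃ a ∈ vertsOf E, ∃ b ∈ vertsOf E, (n : ℤ) ≤ (a 1 - b 1 + 1) ^ 2

/-! ### S5⁺, S4, the counting, the target, S6 -/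

/-- **S5⁺ (JOIN INEQUALITY with the `√n` gain)**: `√n · p_n² ≤ 2 · p_{2n+16}` for even `n ≥ 4`
(`p_n = #normPolygons n`, polygons up to translation): "there are at least an order of `n^ν` locations to which `φ'`
may be translated and then attached to `φ`" with `ν = 1/2`, and the join is injective.
[cite: Hammond2015SAPJoining, §3.4, Step one, eq. (3.6), pp. 12–13 (Madras' counting; arXiv v5)] -/
def JoinIneq2 : Prop :=
  ∀ n : ℕ, Even n → 4 ≤ n →
    Real.sqrt n * ((normPolygons n).card : ℝ) ^ 2 ≤ 2 * ((normPolygons (2 * n + 16)).card : ℝ)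

/-- The specification of the join map at length `n`: a finite domain of size `≥ ½ √n p_n²` (tall `τ` ×
any `σ` × admissible shifts) mapped injectively into `normPolygons (2n+16)`.
[cite: Hammond2015SAPJoining, Definition 4.3 p. 20 (the Madras join polygon J(τ,σ) ∈ SAP_{n+m+16}; arXiv v5)] -/
def JoinMapSpec (n : ℕ) : Prop :=
  ∃ (ι : Type) (D : Finset ι) (Ψ : ι → Finset (Sym2 (Site 2))),
    Real.sqrt n * ((normPolygons n).card : ℝ) ^ 2 ≤ 2 * (D.card : ℝ) ∧
    (∀ x ∈ D, Ψ x ∈ normPolygons (2 * n + 16)) ∧ Set.InjOn Ψ ↑D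

/-- The counting step: an injective map from a domain of size `≥ ½√n p_n²` into `SAP_{2n+16}` gives
`√n p_n² ≤ 2 p_{2n+16}`. [cite: Hammond2015SAPJoining, §3.4, Step one, pp. 12–13 (Madras' counting; arXiv v5)] -/
theorem joinIneq2_of_spec (h : ∀ n : ℕ, Even n → 4 ≤ n → JoinMapSpec n) : JoinIneq2 := by
  intro n hn h4
  obtain ⟨ι, D, Ψ, hcard, hmem, hinj⟩ := h n hn h4
  classical
  have hle : D.card ≤ (normPolygons (2 * n + 16)).card :=
    Finset.card_le_card_of_injOn Ψ (fun x hx => hmem x hx) hinj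
  have hle' : (D.card : ℝ) ≤ (normPolygons (2 * n + 16)).card := by exact_mod_cast hle
  linarith

/-- S4⁺+S3⁺+S2+S1 ⇒ S5⁺: the shape of the counting argument (proved in `SAWPolygonJoinMap.lean`).
[cite: Hammond2015SAPJoining, §4.1 pp. 17–20 and §3.4 pp. 12–13 (arXiv v5)] -/
def Counting2 : Prop := TallHalf → TallHeight → CapGadget → UniqueInteriorEqNeck → JoinIneq2

/-- the polygon growth constant in the `normPolygons` normalisation: `p_{2n}^{1/2n} → μ` (Madras–Slade (3.2.9)).
[cite: MadrasSlade1993, §3.2 eq. (3.2.9)] -/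
def PolygonLimit : Prop :=
  Tendsto (fun n : ℕ => ((normPolygons (2 * n)).card : ℝ) ^ (1 / (2 * (n : ℝ)))) atTop
    (𝓝 (Zd.connectiveConstant 2))

/-- **TARGET (Madras' bound with an explicit constant)**: `p_m ≤ 2 μ^16 (m+16)^{-1/2} μ^m` for every even `m ≥ 4`
(`μ = Zd.connectiveConstant 2`); implies `p_n ≤ A n^{-1/2} μ^n` AS PRINTED with `A = 2 μ^16`.
[cite: Madras1995LatticeAnimalsExponent, §1 (p_n ≤ A n^{-1/2} μ^n in d = 2); Hammond2015SAPJoining, §2 p. 4 (arXiv v5)] -/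
def MAD95_Explicit2 : Prop :=
  ∀ m : ℕ, Even m → 4 ≤ m →
    ((normPolygons m).card : ℝ) ≤
      2 * Zd.connectiveConstant 2 ^ 16 * (((m : ℝ) + 16) ^ (-(1 / 2 : ℝ))) * Zd.connectiveConstant 2 ^ m

/-- S6 (BOOTSTRAP) with constant 2: `Q'_M := ½ √(2M) p_{2M-16}` (`M ≥ 16`) is squared-supermultiplicative by S5⁺ and
`Q'_M^{1/M} → μ²`, so `Q'_M ≤ μ^{2M}` (doubling trick `Literature.Analysis.Asymptotics.Madras1995_doubling`).
[cite: Madras1995LatticeAnimalsExponent, §2 (the a-priori bound from the superadditivity-type inequality)] -/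
def Bootstrap2 : Prop := JoinIneq2 → PolygonLimit → MAD95_Explicit2

/-- The assembly of the route: S1a, S1b, S2, S3⁺, the counting, the bootstrap and the polygon limit give the target.
[cite: Madras1995LatticeAnimalsExponent, §2; Hammond2015SAPJoining, §4.1 (arXiv v5)] -/
theorem mad95_explicit2_of (hS1a : TallHalf) (hS1b : TallHeight) (hS2 : CapGadget)
    (hS3 : UniqueInteriorEqNeck) (hC : Counting2) (hB : Bootstrap2) (hL : PolygonLimit) :
    MAD95_Explicit2 :=
  hB (hC hS1a hS1b hS2 hS3) hL

/-- The explicit form gives the printed `∃ A > 0, p_m ≤ A m^{-1/2} μ^m` form over `normPolygons`.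
[cite: Madras1995LatticeAnimalsExponent, §1 (p_n ≤ A n^{-1/2} μ^n in d = 2)] -/
theorem exists_A_of_explicit2 (h : MAD95_Explicit2) :
    ∃ A : ℝ, 0 < A ∧ ∀ m : ℕ, Even m → 4 ≤ m →
      ((normPolygons m).card : ℝ) ≤ A * ((m : ℝ) ^ (-(1 / 2 : ℝ))) * Zd.connectiveConstant 2 ^ m := by
  have hμ : 0 < Zd.connectiveConstant 2 := Zd.connectiveConstant_pos 2
  refine ⟨2 * Zd.connectiveConstant 2 ^ 16, by positivity, fun m hm h4 => ?_⟩
  have hm0 : (0 : ℝ) < m := by exact_mod_cast (show 0 < m by omega)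
  have key : ((m : ℝ) + 16) ^ (-(1 / 2 : ℝ)) ≤ (m : ℝ) ^ (-(1 / 2 : ℝ)) :=
    Real.rpow_le_rpow_of_nonpos hm0 (by linarith) (by norm_num)
  calc ((normPolygons m).card : ℝ)
      ≤ 2 * Zd.connectiveConstant 2 ^ 16 * (((m : ℝ) + 16) ^ (-(1 / 2 : ℝ))) * Zd.connectiveConstant 2 ^ m :=
        h m hm h4
    _ ≤ 2 * Zd.connectiveConstant 2 ^ 16 * ((m : ℝ) ^ (-(1 / 2 : ℝ))) * Zd.connectiveConstant 2 ^ m := by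
        gcongr

end Literature.Probability.RandomPlanarGeometry.SAW.JoinParity
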